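import Mathlib
import Summits.MatrixMultiplication.MatrixMultiplication.Theses.LevelGradedCohnUmans

/-!
# `SnLevelDesigns` (stmt-MatrixMultiplication-7613), line `garnir-annihilator`:
# F1 `stub_fullBudgetTransfer` — the full-budget `𝔖_k` question implies the crux

Crux `Summit.MatrixMultiplication.MatrixMultiplication.Theses.LevelGradedCohnUmans.SnLevelDesigns`
(lead c3 reshape 7, registered stub F1).

If for every `ε > 0` some `𝔖_k` carries a TPP triple `X, Y, Z` in the Cohn–Kleinberg–Szegedy–Umans
quotient form (`x₀ x⁻¹ · y y'⁻¹ · z z₀⁻¹ = 1 ⇒ x = x₀, y = y', z = z₀`) beating the FULL budget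
`Σ_{ν ⊢ k} (f^ν)^{2+ε} < (|X||Y||Z|)^{(2+ε)/3}`, then the crux holds (the conclusion below is the
crux unfolded).  Proof: take `n := k` and level `k` with the same three sets.
* Separation: for the target `(x₀, z₀)` the table `c p q := [p = id] · [q = x₀⁻¹ z₀]` has token
  function `g ↦ Σ_p c p (g ∘ p) = [g = x₀⁻¹ z₀]`, and by TPP `x⁻¹ y y'⁻¹ z = x₀⁻¹ z₀` holds exactly on
  the target quadruples `x = x₀, y = y', z = z₀` (multiply by `x₀` on the left and `z₀⁻¹` on the
  right).
* Budget: `n - k = 0 ≤ μ₁` for every `μ ⊢ n`, so the graded budget is the full one.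
-/

set_option linter.dupNamespace false

namespace Summit.MatrixMultiplication.MatrixMultiplication.Theorems.SnLevelDesigns

open scoped BigOperators

/-- The token function of the table `c p q := [p = id] · [q = t]` is the indicator of `g = t`:
`Σ_{p : [k] → [k]} c p (g ∘ p) = [g = t]`. -/
private theorem sum_idIndicatorTable {k : ℕ} (g t : Equiv.Perm (Fin k)) :
    (∑ p : Fin k → Fin k,
        (if p = (fun i => i) then (if (⇑g ∘ p) = ⇑t then (1 : ℂ) else 0) else 0)) =
      if g = t then 1 else 0 := by
  rw [Finset.sum_ite_eq_of_mem' Finset.univ (fun i : Fin k => i)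
    (fun p : Fin k → Fin k => if (⇑g ∘ p) = ⇑t then (1 : ℂ) else 0) (Finset.mem_univ _)]
  change (if (⇑g : Fin k → Fin k) = ⇑t then (1 : ℂ) else 0) = _
  by_cases h : g = t
  · rw [if_pos h, if_pos (congrArg _ h)]
  · rw [if_neg h, if_neg fun h' => h (Equiv.ext (congrFun h'))]

/-- Registered stub F1 `stub_fullBudgetTransfer` (lead c3 reshape 7): the positive form of
Blasiak–Church–Cohn–Grochow–Umans 2017 §6's open question — a TPP triple in `𝔖_k` (CKSU quotient
form) beating the full budget `Σ_{ν ⊢ k} (f^ν)^{2+ε}` for every `ε > 0` — implies the crux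
`SnLevelDesigns` (stated here unfolded): take `n := k`, level `k`, the same sets, and for the target
`(x₀, z₀)` the coefficient table `c p q := [p = id] · [q = x₀⁻¹ z₀]`. -/
theorem stub_fullBudgetTransfer :
    (∀ ε : ℝ, 0 < ε → ∃ (k : ℕ) (X Y Z : Finset (Equiv.Perm (Fin k))),
        (∀ x₀ ∈ X, ∀ x ∈ X, ∀ y ∈ Y, ∀ y' ∈ Y, ∀ z ∈ Z, ∀ z₀ ∈ Z,
            x₀ * x⁻¹ * (y * y'⁻¹) * (z * z₀⁻¹) = 1 → x = x₀ ∧ y = y' ∧ z = z₀) ∧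
          (∑ ν : Nat.Partition k, (Literature.NumberTheory.DiophantineGeometry.numStandardTableaux ν : ℝ) ^ (2 + ε)) <
            ((X.card * Y.card * Z.card : ℕ) : ℝ) ^ ((2 + ε) / 3)) →
      ∀ ε : ℝ, 0 < ε → ∃ (n k : ℕ) (X Y Z : Finset (Equiv.Perm (Fin n))),
        (∀ x₀ ∈ X, ∀ z₀ ∈ Z, ∃ c : (Fin k → Fin n) → (Fin k → Fin n) → ℂ,
            ∀ x ∈ X, ∀ y ∈ Y, ∀ y' ∈ Y, ∀ z ∈ Z,
              (∑ p : Fin k → Fin n, c p (⇑(x⁻¹ * y * y'⁻¹ * z) ∘ p)) = if x = x₀ ∧ y = y' ∧ z = z₀ then 1 else 0) ∧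
          (∑ μ : Nat.Partition n, if n - k ≤ μ.parts.sup then
              (Literature.NumberTheory.DiophantineGeometry.numStandardTableaux μ : ℝ) ^ (2 + ε) else 0) <
            ((X.card * Y.card * Z.card : ℕ) : ℝ) ^ ((2 + ε) / 3) := by
  intro hfull ε hε
  obtain ⟨k, X, Y, Z, htpp, hbud⟩ := hfull ε hε
  refine ⟨k, k, X, Y, Z, ?_, ?_⟩
  · -- separation: the indicator of `g = x₀⁻¹ z₀` is a level-`k` token function on `𝔖_k`
    intro x₀ hx₀ z₀ hz₀
    refine ⟨fun p q => if p = (fun i => i) then (if q = ⇑(x₀⁻¹ * z₀) then 1 else 0) else 0,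
      fun x hx y hy y' hy' z hz => ?_⟩
    rw [sum_idIndicatorTable]
    by_cases hc : x = x₀ ∧ y = y' ∧ z = z₀
    · obtain ⟨rfl, rfl, rfl⟩ := hc
      rw [if_pos (show x⁻¹ * y * y⁻¹ * z = x⁻¹ * z by rw [mul_inv_cancel_right]),
        if_pos ⟨rfl, rfl, rfl⟩]
    · rw [if_neg hc, if_neg]
      intro hg
      refine hc (htpp x₀ hx₀ x hx y hy y' hy' z hz z₀ hz₀ ?_)
      calc x₀ * x⁻¹ * (y * y'⁻¹) * (z * z₀⁻¹)
          = x₀ * (x⁻¹ * y * y'⁻¹ * z) * z₀⁻¹ := by group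
        _ = 1 := by rw [hg]; group
  · -- budget: `n - k = k - k = 0 ≤ μ₁`, so the graded budget is the full one
    calc (∑ μ : Nat.Partition k, if k - k ≤ μ.parts.sup then
              (Literature.NumberTheory.DiophantineGeometry.numStandardTableaux μ : ℝ) ^ (2 + ε) else 0)
        = ∑ ν : Nat.Partition k,
            (Literature.NumberTheory.DiophantineGeometry.numStandardTableaux ν : ℝ) ^ (2 + ε) :=
          Finset.sum_congr rfl fun μ _ => if_pos (by rw [Nat.sub_self]; exact Nat.zero_le _)
      _ < ((X.card * Y.card * Z.card : ℕ) : ℝ) ^ ((2 + ε) / 3) := hbud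

end Summit.MatrixMultiplication.MatrixMultiplication.Theorems.SnLevelDesigns
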